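import Mathlib.NumberTheory.Transcendental.Liouville.Basic
import Mathlib.Analysis.Complex.Basic
import Mathlib.Analysis.SpecificLimits.Basic
import HarnessLib

/-!
# Deep cusps with an algebraic slope carry finitely many integer points (Liouville)

The "depth `≥ deg β`" sub-class of the residual cusp atoms of the crux `RigidCore.SparsityTwo`
(idea card cusp-germ-schneider-sparsity, residual stub (★), item (b); e.g. the balanced `∛2`
curve): if `β` is a real irrational root of an integer polynomial `f ≠ 0` of degree `d` and the tail
satisfies `N^{d-1} · r N → 0`, then `βN + r N ∈ ℤ` for only finitely many `N`
(`finite_setOf_slope_hit_of_liouville`). Indeed a hit `L` gives `|β − L/N| = |r N|/N`, while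
Liouville's inequality (Mathlib `Liouville.exists_pos_real_of_irrational_root`) gives
`|β − L/N| ≥ 1/(A N^d)`, so `N^{d-1} |r N| ≥ 1/A` at every hit `N ≥ 1`. [folklore]

## References

* [folklore] Liouville's theorem on rational approximation of algebraic numbers (1844), in the
  form of Mathlib's `Liouville.exists_pos_real_of_irrational_root`.
-/

noncomputable section

open Filter Polynomial
open _root_.Topology

namespace Literature.NumberTheory.Transcendental

/-- **Liouville depth criterion.** Let `β ∈ ℝ` be an irrational root of `f ∈ ℤ[X]`, `f ≠ 0`,
`d = natDegree f`, and let `r : ℕ → ℂ` with `N^{d-1} ‖r N‖ → 0`. Then `{N | βN + r N ∈ ℤ}` is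
finite. [folklore] -/
theorem finite_setOf_slope_hit_of_liouville {β : ℝ} (hirr : Irrational β) {f : ℤ[X]}
    (hf : f ≠ 0) (hroot : eval β (map (algebraMap ℤ ℝ) f) = 0) {r : ℕ → ℂ}
    (hr : Tendsto (fun N : ℕ => (N : ℝ) ^ (f.natDegree - 1) * ‖r N‖) atTop (𝓝 0)) :
    Set.Finite {N : ℕ | ∃ L : ℤ, (β : ℂ) * N + r N = L} := by
  obtain ⟨A, hA, hLiou⟩ := Liouville.exists_pos_real_of_irrational_root hirr hf hroot
  set d := f.natDegree with hd
  -- eventually `N^(d-1) ‖r N‖ < 1/A`, which no hit `N ≥ 1` allows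
  have hsmall : ∀ᶠ N : ℕ in atTop, (N : ℝ) ^ (d - 1) * ‖r N‖ < A⁻¹ :=
    hr.eventually (gt_mem_nhds (inv_pos.mpr hA))
  have hkey : ∀ᶠ N : ℕ in atTop, ∀ L : ℤ, (β : ℂ) * N + r N ≠ L := by
    filter_upwards [hsmall, eventually_gt_atTop 0] with N hN hNpos L hL
    -- at a hit, `r N = L - βN` is real and `|β - L/N| = ‖r N‖ / N`
    have hNR : (0 : ℝ) < N := Nat.cast_pos.mpr hNpos
    have hrN : r N = (((L : ℝ) - β * N : ℝ) : ℂ) := by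
      push_cast
      linear_combination hL
    have hnorm : ‖r N‖ = |(L : ℝ) - β * N| := by
      rw [hrN, Complex.norm_real, Real.norm_eq_abs]
    -- Liouville with `a = L`, `b + 1 = N`
    have hL1 := hLiou L (N - 1)
    have hb1 : (((N - 1 : ℕ) : ℝ) + 1) = (N : ℝ) := by
      rw [Nat.cast_sub (Nat.one_le_iff_ne_zero.mpr hNpos.ne'), Nat.cast_one, sub_add_cancel]
    rw [hb1] at hL1
    have habs : |β - (L : ℝ) / (N : ℝ)| = ‖r N‖ / (N : ℝ) := by
      rw [hnorm, abs_sub_comm (L : ℝ) (β * N)]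
      have : β - (L : ℝ) / (N : ℝ) = (β * N - L) / N := by field_simp
      rw [this, abs_div, abs_of_pos hNR]
    rw [habs] at hL1
    -- `1 ≤ N^d (‖r N‖/N) A = N^(d-1) ‖r N‖ A < A⁻¹ A = 1`
    have hd1 : (N : ℝ) ^ d * (‖r N‖ / (N : ℝ) * A) = (N : ℝ) ^ (d - 1) * ‖r N‖ * A := by
      rcases Nat.eq_zero_or_pos d with h0 | hpos
      · -- `d = 0`: `f` is a nonzero constant and cannot vanish at `β`
        exfalso
        have hfc : f = Polynomial.C (f.coeff 0) := Polynomial.eq_C_of_natDegree_eq_zero (hd ▸ h0)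
        have hc0 : f.coeff 0 ≠ 0 := by
          intro h; apply hf; rw [hfc, h, map_zero]
        rw [hfc, Polynomial.map_C, eval_C] at hroot
        have : ((f.coeff 0 : ℤ) : ℝ) = 0 := by simpa using hroot
        exact hc0 (by exact_mod_cast this)
      · obtain ⟨k, hk⟩ : ∃ k, d = k + 1 := ⟨d - 1, (Nat.succ_pred_eq_of_pos hpos).symm⟩
        rw [hk, Nat.add_sub_cancel, pow_succ]
        field_simp
    rw [hd1] at hL1
    have hlt : (N : ℝ) ^ (d - 1) * ‖r N‖ * A < 1 := by
      calc (N : ℝ) ^ (d - 1) * ‖r N‖ * A < A⁻¹ * A := by gcongr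
        _ = 1 := inv_mul_cancel₀ hA.ne'
    linarith
  -- finiteness from the cofinite filter
  rw [← Nat.cofinite_eq_atTop, Filter.eventually_cofinite] at hkey
  refine hkey.subset ?_
  intro N hN
  simp only [Set.mem_setOf_eq, not_forall, not_not]
  obtain ⟨L, hL⟩ := hN
  exact ⟨L, hL⟩

end Literature.NumberTheory.Transcendental

end
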